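import Summits.QuantumFields.YangMills.Theorems.LuscherReductionRunningReductionAxialGauge
import HarnessLib

/-!
# The axial kernel, explicitly: tree factors `w_β(t_e)`, non-tree factors `w_β(w_e · T_{x+k}(t)⁻¹ · w'_e⁻¹ · T_x(t))`, magnetic weights of the two slices,
# and its row sum (sub-stub C4a″ continued — fixed-lattice programme COARSE(L₀); route `LuscherReduction`, crux RED stmt-QuantumFields-19978 KT-door 3b′ /
# crux `TwistedTraceScaling` stmt-QuantumFields-20203 S-BASE; design note `pub/ym-fleet/ym-luscher-20007-p1/COARSE-DESIGN.md` §4)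

Companion of `…AxialGauge` (`axialKernel β w w' = ∫ K_β(glue w, recon(t, w')) dt`, `qform_eq_axial`).  Here the integrand is made explicit:
* `wilsonAction_recon` — `S(recon(t,w')) = S(glue w')` (gauge invariance);
* `latE_glue_recon` — `E_β(glue w, recon(t,w')) = (∏_{tree i} w_β(t_i)) · ∏_{non-tree i} w_β(w_i · (T_x(t)⁻¹ w'_i T_{x+k}(t))⁻¹)`, `T(t) = treeGauge (extOne t)`
  the comb transporter of the tree data: the `L³ − 1` tree factors are the TEMPORAL links of the axial gauge (Haar-integrated, peaked at `t = 1` with width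
  `β^{−1/2}`), the `2L³ + 1` non-tree factors couple the two slices through the transporters;
* ★ `axialKernel_eq` — `axialKernel β w w' = e^{−(β/2)(S(glue w) + S(glue w'))} · ∫ (∏_{tree} …)(∏_{non-tree} …) dt`;
* ★ `integral_axialKernel_snd` — the row sum `∫ axialKernel β w w' dw' = ∫ K_β(glue w, V) dV` (`≤ e^{−(β/2)S(glue w)} · c_β^{|E|}`, `integral_axialKernel_snd_le`):
  the input of Schur tests in axial gauge.
HONEST FRAMING: bookkeeping; the harmonic (Born–Oppenheimer) analysis of this integrand is OPEN; femto rung R2b1; not infinite volume, not a gap, not Clay.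
-/

set_option autoImplicit false

noncomputable section

open MeasureTheory Filter Topology Real
open scoped Matrix ComplexConjugate BigOperators
open Literature.MathematicalPhysics.QuantumFieldTheory
open Literature.MathematicalPhysics.QuantumLattice

namespace Summit.QuantumFields.YangMills.Theorems.FemtoTransferGap

variable {L : ℕ} [NeZero L]

/-! ## §1 The integrand of the axial kernel -/

/-- `S(recon(t, w')) = S(glue w')`. [folklore] -/
theorem wilsonAction_recon (q : (TreeIdx L → SU2) × (OffIdx L → SU2)) : wilsonAction su2Rep (recon q) = wilsonAction su2Rep (glue q.2) :=
  apply_recon_of_gaugeInvariant (fun g U => wilsonAction_gaugeTransform su2Rep g U) q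

/-- ★ **The electric factor between a glued and a reconstructed configuration**, split into tree and non-tree links. [cite: SeilerLNP1982, §3] -/
theorem latE_glue_recon (β : ℝ) (w w' : OffIdx L → SU2) (t : TreeIdx L → SU2) :
    latE L β (glue w) (recon (t, w')) =
      (∏ i : TreeIdx L, linkW β (t i)) *
        ∏ i : OffIdx L, linkW β (w i * ((treeGauge (extOne t) i.1.1)⁻¹ * w' i * treeGauge (extOne t) (i.1.1.shift i.1.2))⁻¹) := by
  unfold latE
  rw [← Fintype.prod_subtype_mul_prod_subtype (fun e : Edge 3 L => treeEdge e = true)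
    (fun e : Edge 3 L => linkW β (glue w e * (recon (t, w') e)⁻¹))]
  congr 1
  · refine Finset.prod_congr rfl fun i _ => ?_
    rw [glue_apply_of_tree w i.2, recon_apply_of_tree (t, w') i.2, one_mul, linkW_inv]
  · refine Finset.prod_congr rfl fun i _ => ?_
    rw [glue_apply_of_not_tree w i.2, recon_apply_of_not_tree (t, w') i.2]

/-- The transfer kernel between a glued and a reconstructed configuration. [cite: SeilerLNP1982, §3] -/
theorem transferKernel_glue_recon (β : ℝ) (w w' : OffIdx L → SU2) (t : TreeIdx L → SU2) :
    transferKernel su2Rep β (glue w) (recon (t, w')) =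
      ((∏ i : TreeIdx L, linkW β (t i)) *
        ∏ i : OffIdx L, linkW β (w i * ((treeGauge (extOne t) i.1.1)⁻¹ * w' i * treeGauge (extOne t) (i.1.1.shift i.1.2))⁻¹)) *
        Real.exp (-(β / 2) * (wilsonAction su2Rep (glue w) + wilsonAction su2Rep (glue w'))) := by
  rw [transferKernel_eq_latE_mul, latE_glue_recon, wilsonAction_recon]

/-- ★ **The axial kernel, explicitly**: magnetic weights of the two slices times the Haar integral over the tree data of the tree and non-tree electric
factors. [cite: SeilerLNP1982, §3] [cite: Luscher1983, §2] -/
theorem axialKernel_eq (β : ℝ) (w w' : OffIdx L → SU2) :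
    axialKernel β w w' = Real.exp (-(β / 2) * (wilsonAction su2Rep (glue w) + wilsonAction su2Rep (glue w'))) *
      ∫ t, (∏ i : TreeIdx L, linkW β (t i)) *
        ∏ i : OffIdx L, linkW β (w i * ((treeGauge (extOne t) i.1.1)⁻¹ * w' i * treeGauge (extOne t) (i.1.1.shift i.1.2))⁻¹)
        ∂(Measure.pi fun _ : TreeIdx L => haarProbability SU2) := by
  unfold axialKernel
  simp_rw [transferKernel_glue_recon]
  rw [integral_mul_const, mul_comm]

/-! ## §2 The row sum of the axial kernel -/

/-- ★ **Row sum**: `∫ axialKernel β w w' dw' = ∫ K_β(glue w, V) dV` (`β ≥ 0`). [folklore] -/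
theorem integral_axialKernel_snd {β : ℝ} (hβ : 0 ≤ β) (w : OffIdx L → SU2) :
    ∫ w', axialKernel β w w' ∂(Measure.pi fun _ : OffIdx L => haarProbability SU2) =
      ∫ V, transferKernel su2Rep β (glue w) V ∂configMeasure SU2 L := by
  have h := transferPotential_glue_eq_axial hβ (G := fun _ : GaugeConfig 3 L SU2 => (1 : ℝ)) measurable_const (C := 1) (fun _ => by simp)
    (fun _ _ => rfl) w
  simp only [mul_one] at h
  exact h.symm

/-- The row sum is at most `e^{−(β/2)S(glue w)} · c_β^{|E|}` (`β ≥ 0`). [folklore] -/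
theorem integral_axialKernel_snd_le {β : ℝ} (hβ : 0 ≤ β) (w : OffIdx L → SU2) :
    ∫ w', axialKernel β w w' ∂(Measure.pi fun _ : OffIdx L => haarProbability SU2) ≤
      Real.exp (-(β / 2) * wilsonAction su2Rep (glue w)) * latCE L β := by
  rw [integral_axialKernel_snd hβ]
  have hpt : ∀ V : GaugeConfig 3 L SU2, transferKernel su2Rep β (glue w) V ≤ Real.exp (-(β / 2) * wilsonAction su2Rep (glue w)) * latE L β (glue w) V := by
    intro V
    rw [transferKernel_eq_latE_mul, mul_comm]
    refine mul_le_mul_of_nonneg_right (Real.exp_le_exp.2 ?_) (latE_pos β _ _).le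
    have hS := wilsonAction_su2_nonneg_lat V
    nlinarith
  have hmE : Measurable (latE L β (glue w)) := Measurable.of_uncurry_left (f := latE L β) (measurable_latE β)
  have hint : Integrable (fun V => Real.exp (-(β / 2) * wilsonAction su2Rep (glue w)) * latE L β (glue w) V) (configMeasure SU2 L) :=
    (integrable_of_bounded_lat hmE (abs_latE_le hβ (glue w))).const_mul _
  calc ∫ V, transferKernel su2Rep β (glue w) V ∂configMeasure SU2 L
      ≤ ∫ V, Real.exp (-(β / 2) * wilsonAction su2Rep (glue w)) * latE L β (glue w) V ∂configMeasure SU2 L :=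
        integral_mono (integrable_of_bounded_lat (measurable_transferKernel_left β (glue w)) (fun V => abs_transferKernel_le_lat hβ (glue w, V))) hint hpt
    _ = Real.exp (-(β / 2) * wilsonAction su2Rep (glue w)) * latCE L β := by rw [integral_const_mul, integral_latE_snd]

end Summit.QuantumFields.YangMills.Theorems.FemtoTransferGap

end
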